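import Literature.AlgebraicGeometry.Resolution.KnafKuhlmann2009Thm11Parts
import Literature.AlgebraicGeometry.Resolution.ValuationDefect
import Mathlib.FieldTheory.SeparableClosure
import Mathlib.FieldTheory.Galois.Infinite
import Mathlib.RingTheory.Valuation.RamificationGroup
import HarnessLib

/-!
# Henselian valued fields and the henselization (Kuhlmann 2010, §1.1, Lemmas 2.2–2.3, Thm. 2.14)

Topic: `Literature/AlgebraicGeometry/Resolution` (valued function fields). The vocabulary on
which the remaining named facts of the decomposition of `Kuhlmann2010Stability`
(`Kuhlmann2010DefectlessDescent` = Cor. 2.25, `Kuhlmann2010StabilityAlgClosedValueTranscendental`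
= (R2), `GeneralizedStabilityTrdegOne.lean`) and the bundled Knaf–Kuhlmann facts
(`KnafKuhlmann2009_Thm38_Lemma37_sepClosed`, "so that neither the henselization `K(x)^h` nor the
absolute inertia field has to be rendered (Mathlib has no henselization of valued fields)")
rest: the HENSELIZATION of a valued field, following F.-V. Kuhlmann, *Elimination of
ramification I*, Trans. AMS 362 (2010) = arXiv:1003.5678, §1.1:

> Take a valued field `(K,v)` and fix an extension of the valuation `v` to the
> separable-algebraic closure `K^sep` of `K`. Then the absolute ramification field `K^r`, the
> absolute inertia field `K^i`, and the henselization `K^h` of `(K,v)` (with respect to the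
> chosen extension of `v`) are the ramification field, the inertia field and the decomposition
> field, respectively, of the extension `(K^sep|K,v)`. Since all extensions of the valuation
> `v` from `K` to `K^sep` are conjugate (i.e., are obtained from each other by composing with an
> automorphism of `K^sep|K`), these fields are unique up to valuation preserving isomorphism.
> … If `K^h = K`, then `(K,v)` is called henselian. This holds if and only if the extension of
> `v` from `K` to every algebraic extension field is unique.

## Content

* `IsHenselianField K O` — **henselian valued field**: the valuation ring `O` of `K` has a
  unique extension to every algebraic extension field of `K` (the source's characterization;
  the equivalence with Hensel's Lemma — Mathlib's `HenselianLocalRing O` — is classical,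
  [En] §16, and not proved here). DEFINITION; `IsHenselianField.of_isAlgebraic` — Lemma 2.3,
  first sentence ("An algebraic extension of a henselian valued field, equipped with the unique
  extension of the valuation, is again henselian"). PROVED.
* Ambient rendering (`ValuedFunctionFields.lean`: one valued field `(Ω, V)`, subfields
  `E ≤ Ω`): `sepClosureValuationSubring V E` — the restriction of `V` to the separable closure
  `E^sep = separableClosure E Ω` (a separable-algebraic closure of `E` when `Ω` is
  algebraically closed); `decompositionGroup V E` — the decomposition group
  `{σ ∈ Gal(E^sep|E) : σ(V ∩ E^sep) = V ∩ E^sep}` (Mathlib's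
  `ValuationSubring.decompositionSubgroup`); `henselization V E` — **the henselization
  `E^h ⊆ E^sep ⊆ Ω` of `(E, V ∩ E)` with respect to `V`**: the decomposition field, i.e. the
  fixed field of the decomposition group. DEFINITIONS, with API: `mem_henselization_iff`,
  `le_henselization` (`E ≤ E^h`), `henselization_le_separableClosure` (`E^h ≤ E^sep`),
  `isSeparable_of_mem_henselization`, and the sanity check `henselization_top` — for the
  TRIVIAL valuation `V = Ω` the decomposition group is all of `Gal(E^sep|E)` and `E^h = E`
  (infinite Galois theory, `InfiniteGalois.mem_bot_iff_fixed`). PROVED.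
* `henselization_le_of_isHenselianField` — **`E^h` lies in every henselian `F`, `E ≤ F ≤ Ω`**
  (the ambient form of the universal property of Lemma 2.2), PROVED: an automorphism of
  `F^sep|F` preserves `V ∩ F^sep` by henselianity, so restricts to an element of the
  decomposition group of `E^sep|E`; hence `E^h` is fixed by `Gal(F^sep|F)`, i.e. `E^h ≤ F`.
  Corollaries: `henselization_eq_self_of_isHenselianField` (henselian ⇒ `E^h = E`, §1.1),
  and — from the named fact that `E^h` is henselian — `henselization_henselization`
  (`(E^h)^h = E^h`) and `henselization_mono` (`E ≤ F ⇒ E^h ≤ F^h`). PROVED.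
* NAMED FACTS (all for `Ω` algebraically closed):
  `Kuhlmann2010ExtensionsConjugate` (§1.1: the extensions of `V ∩ E` to `E^sep` are conjugate
  under `Gal(E^sep|E)`), `Kuhlmann2010HenselizationIsHenselian` (§1.1 with Lemma 2.3:
  `(E^h, V ∩ E^h)` is henselian), `Kuhlmann2010HenselizationImmediate` (Lemma 2.2: `E^h|E` is
  immediate), `Kuhlmann2010HenselizationUniversal` (Lemma 2.2: the universal property),
  `Kuhlmann2010DefectlessIffHenselization` (Thm. 2.14: `(E, v)` is defectless iff `(E^h, v)`
  is defectless).

## Sources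

* F.-V. Kuhlmann, *Elimination of ramification I: The generalized stability theorem*, Trans.
  Amer. Math. Soc. 362 (2010) 5697–5727 = arXiv:1003.5678: §1.1 (henselization, henselian
  fields, conjugacy of extensions), §2.1 Lemma 2.2, Lemma 2.3, §2.3 Thm. 2.14 ("[En], Theorem
  (18.2) … See [K6] for more details"), with [En] = O. Endler, *Valuation theory*, Springer
  1972, and [K6] = F.-V. Kuhlmann, *A classification of Artin–Schreier defect extensions and
  characterizations of defectless fields*, Illinois J. Math. 54 (2010).

## Rendering notes

* The "chosen extension of `v` to `K^sep`" is the restriction of the ambient `V` to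
  `E^sep ⊆ Ω`; for `Ω` algebraically closed `separableClosure E Ω` is a separable closure of
  `E` (`separableClosure.isSepClosure`) and `E^sep|E` is Galois (`IsSepClosure.isGalois`), so
  `henselization V E` is the source's `K^h` for `K = E` with respect to `V ∩ E^sep`. The named
  facts assume `[IsAlgClosed Ω]`; the definitions do not need it.
* `IsHenselianField` is typed (any valued field `(K, O)`, like `IsDefectlessField`); in the
  ambient setting it is applied to `(↥F, V.comap (algebraMap F Ω))`.
* `E^h` is an `E`-algebra through the inclusion `E ≤ E^h` (`henselization.algebra`), as needed
  to state the universal property with `E`-algebra maps `E^h →ₐ[E] L`.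
-/

noncomputable section

open IsLocalRing
open scoped Pointwise

namespace Literature.AlgebraicGeometry.Resolution

universe u

/-! ### Henselian valued fields -/

section Henselian

/-- **Henselian valued field** (Kuhlmann 2010, §1.1: "If `K^h = K`, then `(K,v)` is called
henselian. This holds if and only if the extension of `v` from `K` to every algebraic extension
field is unique (implying that `g = 1` in (1)), or equivalently, if and only if `(K,v)`
satisfies Hensel's Lemma"). Rendered by the uniqueness characterization: for every algebraic
extension field `L` of `K`, any two valuation rings of `L` lying over `O = K°` coincide.
[cite: Kuhlmann2010, Section 1.1] -/
def IsHenselianField (K : Type u) [Field K] (O : ValuationSubring K) : Prop :=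
  ∀ (L : Type u) [Field L] [Algebra K L], Algebra.IsAlgebraic K L →
    ∀ O₁ O₂ : ValuationSubring L,
      O₁.comap (algebraMap K L) = O → O₂.comap (algebraMap K L) = O → O₁ = O₂

variable {K L : Type u} [Field K] [Field L] [Algebra K L] {O : ValuationSubring K}

/-- **Kuhlmann 2010, Lemma 2.3 (first part)**: "An algebraic extension of a henselian valued
field, equipped with the unique extension of the valuation, is again henselian" — for any
valuation ring `O_L` of an algebraic extension `L` lying over `O` (it is the unique one).
PROVED (an algebraic extension of `L` is an algebraic extension of `K`).
[cite: Kuhlmann2010, Lemma 2.3] -/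
theorem IsHenselianField.of_isAlgebraic [Algebra.IsAlgebraic K L] (h : IsHenselianField K O)
    (OL : ValuationSubring L) (hOL : OL.comap (algebraMap K L) = O) : IsHenselianField L OL := by
  intro M _ _ hM O₁ O₂ h₁ h₂
  haveI := hM
  letI : Algebra K M := ((algebraMap L M).comp (algebraMap K L)).toAlgebra
  haveI : IsScalarTower K L M := IsScalarTower.of_algebraMap_eq fun _ => rfl
  haveI : Algebra.IsAlgebraic K M := Algebra.IsAlgebraic.trans K L M
  refine h M inferInstance O₁ O₂ ?_ ?_
  · rw [IsScalarTower.algebraMap_eq K L M, ← ValuationSubring.comap_comap, h₁, hOL]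
  · rw [IsScalarTower.algebraMap_eq K L M, ← ValuationSubring.comap_comap, h₂, hOL]

/-- Over a henselian `(K, O)`, the valuation ring of an algebraic extension lying over `O` is
unique ("implying that `g = 1`"). [cite: Kuhlmann2010, Section 1.1] -/
theorem IsHenselianField.eq_of_comap_eq [Algebra.IsAlgebraic K L] (h : IsHenselianField K O)
    {O₁ O₂ : ValuationSubring L} (h₁ : O₁.comap (algebraMap K L) = O)
    (h₂ : O₂.comap (algebraMap K L) = O) : O₁ = O₂ :=
  h L inferInstance O₁ O₂ h₁ h₂

end Henselian

/-! ### The henselization inside an ambient valued field -/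

section Ambient

variable {Ω : Type u} [Field Ω] (V : ValuationSubring Ω) (E : Subfield Ω)

/-- The chosen extension of `V ∩ E` to the separable closure `E^sep ⊆ Ω` of `E`: the
restriction of `V` (Kuhlmann 2010, §1.1: "fix an extension of the valuation `v` to the
separable-algebraic closure `K^sep` of `K`"). [cite: Kuhlmann2010, Section 1.1] -/
def sepClosureValuationSubring : ValuationSubring (separableClosure E Ω) :=
  V.comap (algebraMap (separableClosure E Ω) Ω)

/-- Membership in `V ∩ E^sep`. [folklore] -/
@[simp]
theorem mem_sepClosureValuationSubring_iff (x : separableClosure E Ω) :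
    x ∈ sepClosureValuationSubring V E ↔ (x : Ω) ∈ V := Iff.rfl

/-- **The decomposition group** of `(E^sep|E, v)`: the automorphisms of `E^sep` over `E`
mapping the valuation ring `V ∩ E^sep` onto itself (Mathlib: the stabilizer
`ValuationSubring.decompositionSubgroup`). [cite: Kuhlmann2010, Section 1.1] -/
def decompositionGroup :
    Subgroup ((separableClosure E Ω) ≃ₐ[E] (separableClosure E Ω)) :=
  ValuationSubring.decompositionSubgroup E (sepClosureValuationSubring V E)

/-- Membership in the decomposition group: `σ(V ∩ E^sep) = V ∩ E^sep`. [folklore] -/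
theorem mem_decompositionGroup_iff (σ : (separableClosure E Ω) ≃ₐ[E] (separableClosure E Ω)) :
    σ ∈ decompositionGroup V E ↔
      σ • sepClosureValuationSubring V E = sepClosureValuationSubring V E :=
  MulAction.mem_stabilizer_iff

/-- **The henselization `E^h` of `(E, V ∩ E)` inside `(Ω, V)`** (Kuhlmann 2010, §1.1: "the
henselization `K^h` of `(K,v)` (with respect to the chosen extension of `v`) [is] the
decomposition field of the extension `(K^sep|K,v)`"): the fixed field in `E^sep ⊆ Ω` of the
decomposition group of `V ∩ E^sep`, as a subfield of `Ω` (valued by `V ∩ E^h`).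
[cite: Kuhlmann2010, Section 1.1] -/
def henselization : Subfield Ω :=
  (IntermediateField.lift (IntermediateField.fixedField (decompositionGroup V E))).toSubfield

/-- `x ∈ E^h` iff `x ∈ E^sep` is fixed by the decomposition group. [folklore] -/
theorem mem_henselization_iff {x : Ω} :
    x ∈ henselization V E ↔ ∃ hx : x ∈ separableClosure E Ω,
      ∀ σ ∈ decompositionGroup V E, σ ⟨x, hx⟩ = ⟨x, hx⟩ := by
  constructor
  · intro h
    obtain ⟨y, hy, rfl⟩ := (IntermediateField.mem_map _).mp (show x ∈ IntermediateField.lift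
      (IntermediateField.fixedField (decompositionGroup V E)) from h)
    exact ⟨y.2, fun σ hσ => (IntermediateField.mem_fixedField_iff _ _).mp hy σ hσ⟩
  · rintro ⟨hx, h⟩
    have hy : (⟨x, hx⟩ : separableClosure E Ω) ∈
        IntermediateField.fixedField (decompositionGroup V E) :=
      (IntermediateField.mem_fixedField_iff _ _).mpr h
    exact (IntermediateField.mem_lift ⟨x, hx⟩).mpr hy

/-- `E ≤ E^h`. [folklore] -/
theorem le_henselization : E ≤ henselization V E := by
  intro x hx
  rw [mem_henselization_iff]
  refine ⟨(separableClosure E Ω).algebraMap_mem ⟨x, hx⟩, fun σ _ => ?_⟩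
  exact σ.commutes ⟨x, hx⟩

/-- `E^h ≤ E^sep`. [folklore] -/
theorem henselization_le_separableClosure :
    henselization V E ≤ (separableClosure E Ω).toSubfield := fun _ hx =>
  ((mem_henselization_iff V E).mp hx).1

/-- Elements of `E^h` are separable (algebraic) over `E` (Lemma 2.2: `K^h|K` is a
"separable-algebraic extension"). PROVED. [cite: Kuhlmann2010, Lemma 2.2] -/
theorem isSeparable_of_mem_henselization {x : Ω} (hx : x ∈ henselization V E) :
    IsSeparable E x :=
  mem_separableClosure_iff.mp (henselization_le_separableClosure V E hx)

/-- `E^h` as an `E`-algebra through `E ≤ E^h`. [folklore] -/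
instance henselization.algebra : Algebra E (henselization V E) :=
  (Subfield.inclusion (le_henselization V E)).toAlgebra

/-- `E → E^h → Ω` is a tower of inclusions. [folklore] -/
instance henselization.isScalarTower : IsScalarTower E (henselization V E) Ω :=
  IsScalarTower.of_algebraMap_eq fun _ => rfl

/-- **Sanity check: the henselization of a trivially valued field is the field itself.** For
the trivial valuation ring `V = Ω` the decomposition group is the whole Galois group of
`E^sep|E`, whose fixed field is `E` (infinite Galois theory); `Ω` algebraically closed makes
`E^sep` a separable closure. PROVED. [folklore] -/
theorem henselization_top [IsAlgClosed Ω] : henselization (⊤ : ValuationSubring Ω) E = E := by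
  have hV : sepClosureValuationSubring (⊤ : ValuationSubring Ω) E = ⊤ := by
    ext x
    simp only [mem_sepClosureValuationSubring_iff, ValuationSubring.mem_top]
  have hD : decompositionGroup (⊤ : ValuationSubring Ω) E = ⊤ := by
    refine eq_top_iff.mpr fun σ _ => ?_
    rw [mem_decompositionGroup_iff, hV]
    ext x
    simp only [ValuationSubring.mem_top, iff_true]
    exact (ValuationSubring.mem_smul_pointwise_iff_exists σ x ⊤).mpr
      ⟨σ.symm x, ValuationSubring.mem_top _, σ.apply_symm_apply x⟩
  refine le_antisymm (fun x hx => ?_) (le_henselization ⊤ E)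
  obtain ⟨hx, h⟩ := (mem_henselization_iff ⊤ E).mp hx
  have hall : ∀ σ : (separableClosure E Ω) ≃ₐ[E] (separableClosure E Ω), σ ⟨x, hx⟩ = ⟨x, hx⟩ :=
    fun σ => h σ (hD ▸ Subgroup.mem_top σ)
  obtain ⟨y, hy⟩ := IntermediateField.mem_bot.mp
    ((InfiniteGalois.mem_bot_iff_fixed (k := E) (⟨x, hx⟩ : separableClosure E Ω)).mpr hall)
  have hyx : ((y : E) : Ω) = x := congrArg (fun z : separableClosure E Ω => (z : Ω)) hy
  rw [← hyx]
  exact y.2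

/-- **The henselization lies in every henselian subfield of `Ω` containing `E`** (the
ambient form of the universal property, Lemma 2.2: "a henselization of `(K,v)` can be chosen
in every henselian valued extension field of `(K,v)`"; here, inside the fixed `(Ω, V)`, the
henselization with respect to `V` is literally contained in every henselian `(F, V ∩ F)`,
`E ≤ F ≤ Ω`). PROVED: an automorphism `τ` of `F^sep|F` preserves `V ∩ F^sep` because
`(F, V ∩ F)` is henselian and `F^sep|F` is algebraic, so its restriction to the normal
subextension `E^sep|E` lies in the decomposition group and fixes every `x ∈ E^h`; thus `x` is
fixed by `Gal(F^sep|F)`, i.e. `x ∈ F` (infinite Galois theory). [cite: Kuhlmann2010, Lemma 2.2] -/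
theorem henselization_le_of_isHenselianField [IsAlgClosed Ω] {F : Subfield Ω} (hEF : E ≤ F)
    (hF : IsHenselianField F (V.comap (algebraMap F Ω))) : henselization V E ≤ F := by
  intro x hx
  obtain ⟨hxs, hfix⟩ := (mem_henselization_iff V E).mp hx
  -- `E ≤ F ≤ F^sep ≤ Ω` as algebras
  letI : Algebra E F := (Subfield.inclusion hEF).toAlgebra
  haveI : IsScalarTower E F Ω := IsScalarTower.of_algebraMap_eq fun _ => rfl
  let Fs : IntermediateField F Ω := separableClosure F Ω
  haveI : IsScalarTower E Fs Ω := IsScalarTower.of_algebraMap_eq fun _ => rfl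
  -- `E^sep ≤ F^sep`
  have hle : ∀ z : separableClosure E Ω, (z : Ω) ∈ Fs := fun z =>
    separableClosure.le_restrictScalars E F Ω z.2
  let j : separableClosure E Ω →+* Fs :=
    (algebraMap (separableClosure E Ω) Ω).codRestrict Fs hle
  letI : Algebra (separableClosure E Ω) Fs := j.toAlgebra
  haveI : IsScalarTower E (separableClosure E Ω) Fs :=
    IsScalarTower.of_algebraMap_eq fun _ => Subtype.ext rfl
  have hxF : x ∈ Fs := hle ⟨x, hxs⟩
  -- it suffices that `x` is fixed by `Gal(F^sep|F)`
  suffices hall : ∀ τ : Fs ≃ₐ[F] Fs, τ ⟨x, hxF⟩ = ⟨x, hxF⟩ by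
    obtain ⟨y, hy⟩ := IntermediateField.mem_bot.mp
      ((InfiniteGalois.mem_bot_iff_fixed (k := F) (⟨x, hxF⟩ : Fs)).mpr hall)
    have hyx : ((y : F) : Ω) = x := congrArg (fun z : Fs => (z : Ω)) hy
    rw [← hyx]
    exact y.2
  intro τ
  -- `τ` preserves `V ∩ F^sep`: both `V ∩ F^sep` and `τ⁻¹(V ∩ F^sep)` lie over `V ∩ F`
  have hA : V.comap (algebraMap Fs Ω) =
      (V.comap (algebraMap Fs Ω)).comap τ.toAlgHom.toRingHom := by
    refine hF Fs inferInstance _ _ ?_ ?_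
    · rw [ValuationSubring.comap_comap, ← IsScalarTower.algebraMap_eq]
    · rw [ValuationSubring.comap_comap, ValuationSubring.comap_comap]
      congr 1
      ext c
      change algebraMap Fs Ω (τ (algebraMap F Fs c)) = algebraMap F Ω c
      rw [AlgEquiv.commutes, ← IsScalarTower.algebraMap_apply]
  have hτV : ∀ z : Fs, (z : Ω) ∈ V ↔ ((τ z : Fs) : Ω) ∈ V := fun z =>
    SetLike.ext_iff.mp hA z
  -- the restriction `σ` of `τ` to the normal subextension `E^sep|E`
  let σ : (separableClosure E Ω) ≃ₐ[E] (separableClosure E Ω) :=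
    (τ.restrictScalars E).restrictNormal (separableClosure E Ω)
  have hσ : ∀ z : separableClosure E Ω,
      ((σ z : separableClosure E Ω) : Ω) = ((τ ⟨z, hle z⟩ : Fs) : Ω) := fun z =>
    congrArg (fun w : Fs => (w : Ω))
      (AlgEquiv.restrictNormal_commutes (τ.restrictScalars E) (separableClosure E Ω) z)
  -- `σ` lies in the decomposition group
  have hσD : σ ∈ decompositionGroup V E := by
    rw [mem_decompositionGroup_iff]
    ext w
    rw [ValuationSubring.mem_pointwise_smul_iff_inv_smul_mem, mem_sepClosureValuationSubring_iff,
      mem_sepClosureValuationSubring_iff, AlgEquiv.smul_def, hτV ⟨_, hle (σ⁻¹ w)⟩, ← hσ (σ⁻¹ w),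
      AlgEquiv.aut_inv, AlgEquiv.apply_symm_apply]
  -- hence `σ` fixes `x`, and so does `τ`
  have hfx := hfix σ hσD
  apply Subtype.ext
  change ((τ ⟨x, hxF⟩ : Fs) : Ω) = x
  rw [← hσ ⟨x, hxs⟩, hfx]

end Ambient

/-! ### Named facts: conjugacy, Lemma 2.2, Lemma 2.3, Thm. 2.14 -/

/-- NAMED FACT — **conjugacy of the extensions of a valuation to the separable closure**
(Kuhlmann 2010, §1.1: "Since all extensions of the valuation `v` from `K` to `K^sep` are
conjugate (i.e., are obtained from each other by composing with an automorphism of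
`K^sep|K`), these fields are unique up to valuation preserving isomorphism"). Rendering: for
`Ω` algebraically closed and two valuation rings `V, W` of `Ω` inducing the same valuation
ring on `E`, their restrictions to `E^sep` differ by an automorphism of `E^sep|E`. (Classical:
[En] §14; [Z–S] VI §7.) Users take `(h : Kuhlmann2010ExtensionsConjugate)`.
[cite: Kuhlmann2010, Section 1.1] -/
def Kuhlmann2010ExtensionsConjugate : Prop :=
  ∀ (Ω : Type u) [Field Ω] [IsAlgClosed Ω] (V W : ValuationSubring Ω) (E : Subfield Ω),
    (∀ x ∈ E, x ∈ W ↔ x ∈ V) →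
    ∃ σ : (separableClosure E Ω) ≃ₐ[E] (separableClosure E Ω),
      σ • sepClosureValuationSubring V E = sepClosureValuationSubring W E

/-- NAMED FACT — **the henselization is henselian** (Kuhlmann 2010, §1.1: "If `K^h = K`, then
`(K,v)` is called henselian. This holds if and only if the extension of `v` from `K` to every
algebraic extension field is unique"; Lemma 2.3: "If `L|K` is algebraic, then `(L.K^h,v)` is
the henselization of `(L,v)`" — with `L = K^h`: `(K^h)^h = K^h`, so `(K^h, v)` is henselian).
Rendering: for `Ω` algebraically closed, `(E^h, V ∩ E^h)` is a henselian valued field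
(`IsHenselianField`). Users take `(h : Kuhlmann2010HenselizationIsHenselian)`.
[cite: Kuhlmann2010, Section 1.1 and Lemma 2.3] -/
def Kuhlmann2010HenselizationIsHenselian : Prop :=
  ∀ (Ω : Type u) [Field Ω] [IsAlgClosed Ω] (V : ValuationSubring Ω) (E : Subfield Ω),
    IsHenselianField (henselization V E) (V.comap (algebraMap (henselization V E) Ω))

/-- NAMED FACT — **Kuhlmann 2010, Lemma 2.2 (the henselization is immediate)**: "The
henselization `K^h` of a valued field `(K,v)` … is an immediate separable-algebraic extension"
(immediate, §2.1: "the canonical embeddings of `vK` in `vL` and of `Kv` in `Lv` are onto").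
Rendering: for `Ω` algebraically closed, `E^h|E` is immediate with respect to `V`
(`IsImmediateOver`: every value and every residue of `E^h` is one of `E`); separability is
`isSeparable_of_mem_henselization`. Users take `(h : Kuhlmann2010HenselizationImmediate)`.
[cite: Kuhlmann2010, Lemma 2.2] -/
def Kuhlmann2010HenselizationImmediate : Prop :=
  ∀ (Ω : Type u) [Field Ω] [IsAlgClosed Ω] (V : ValuationSubring Ω) (E : Subfield Ω),
    IsImmediateOver V E (henselization V E)

/-- NAMED FACT — **Kuhlmann 2010, Lemma 2.2 (universal property of the henselization)**: the
henselization "has the following universal property: if `(L,v')` is an arbitrary henselian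
extension field of `(K,v)`, then there is a unique valuation preserving embedding of `(K^h,v)`
in `(L,v')` over `K`." Rendering: for `Ω` algebraically closed, `E ≤ Ω` valued by `V ∩ E`, and
a henselian valued field `(L, O_L)` which is an `E`-algebra with `O_L ∩ E = V ∩ E`, there is a
unique `E`-algebra map `ι : E^h → L` with `ι⁻¹(O_L) = V ∩ E^h`. Users take
`(h : Kuhlmann2010HenselizationUniversal)`. [cite: Kuhlmann2010, Lemma 2.2] -/
def Kuhlmann2010HenselizationUniversal : Prop :=
  ∀ (Ω : Type u) [Field Ω] [IsAlgClosed Ω] (V : ValuationSubring Ω) (E : Subfield Ω)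
    (L : Type u) [Field L] [Algebra E L] (OL : ValuationSubring L),
    IsHenselianField L OL → OL.comap (algebraMap E L) = V.comap (algebraMap E Ω) →
    ∃! ι : henselization V E →ₐ[E] L,
      OL.comap ι.toRingHom = V.comap (algebraMap (henselization V E) Ω)

/-- NAMED FACT — **Kuhlmann 2010, Thm. 2.14**: "Take a valued field `(K,v)` and fix an
extension of `v` to `K̃`. Then `(K,v)` is defectless if and only if its henselization
`(K,v)^h` in `(K̃,v)` is defectless." (Proof: "[En], Theorem (18.2) … See [K6] for more
details.") Rendering: for `Ω` algebraically closed (so `K̃ ⊆ Ω` and the henselization in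
`(K̃, v)` is `henselization V E`), `(E, V ∩ E)` is a defectless field iff `(E^h, V ∩ E^h)`
is. Users take `(h : Kuhlmann2010DefectlessIffHenselization)`.
[cite: Kuhlmann2010, Thm. 2.14] -/
def Kuhlmann2010DefectlessIffHenselization : Prop :=
  ∀ (Ω : Type u) [Field Ω] [IsAlgClosed Ω] (V : ValuationSubring Ω) (E : Subfield Ω),
    IsDefectlessField E (V.comap (algebraMap E Ω)) ↔
      IsDefectlessField (henselization V E) (V.comap (algebraMap (henselization V E) Ω))

/-! ### Consequences -/

section Consequences

variable {Ω : Type u} [Field Ω] [IsAlgClosed Ω] (V : ValuationSubring Ω)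

/-- **A henselian field is its own henselization** (§1.1: "If `K^h = K`, then `(K,v)` is called
henselian" — the direction henselian ⇒ `K^h = K` of the equivalence with the uniqueness
characterization). PROVED from `henselization_le_of_isHenselianField`.
[cite: Kuhlmann2010, Section 1.1] -/
theorem henselization_eq_self_of_isHenselianField (E : Subfield Ω)
    (hE : IsHenselianField E (V.comap (algebraMap E Ω))) : henselization V E = E :=
  le_antisymm (henselization_le_of_isHenselianField V E le_rfl hE) (le_henselization V E)

/-- `(E^h)^h = E^h`, from the named fact that `E^h` is henselian. [cite: Kuhlmann2010, Lemma 2.3] -/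
theorem henselization_henselization (h : Kuhlmann2010HenselizationIsHenselian.{u})
    (E : Subfield Ω) : henselization V (henselization V E) = henselization V E :=
  henselization_eq_self_of_isHenselianField V _ (h Ω V E)

/-- **The henselization is monotone**: `E ≤ F ⇒ E^h ≤ F^h` (inside `(Ω, V)`), from the named
fact that `F^h` is henselian and `henselization_le_of_isHenselianField`. [folklore] -/
theorem henselization_mono (h : Kuhlmann2010HenselizationIsHenselian.{u}) {E F : Subfield Ω}
    (hEF : E ≤ F) : henselization V E ≤ henselization V F :=
  henselization_le_of_isHenselianField V E (hEF.trans (le_henselization V F)) (h Ω V F)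

end Consequences

end Literature.AlgebraicGeometry.Resolution
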